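import Summits.SmoothPoincare4.SmoothPoincare4.Theses.EntropyRung
import Mathlib.Analysis.SpecialFunctions.SmoothTransition
import Mathlib.Analysis.SpecialFunctions.Integrals.Basic
import Mathlib.Analysis.SpecialFunctions.Sqrt
import Mathlib.MeasureTheory.Integral.IntervalIntegral.FundThmCalculus
import Mathlib.Analysis.Calculus.Deriv.Slope
import HarnessLib

/-!
# The radial profile of the smoothed cone of slope `c`
(aux file 2 of stub `helper_smoothedConeModel`, line `fat-conical-core-avr-logsobolev`, crux
`EntropyRung.SubcylindricalExistence`, item stmt-SmoothPoincare4-10871)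

For `0 < c ≤ 1` we construct two smooth functions `θ, Ψ : ℝ → ℝ` (`helper_smoothedConeModel_profile`):
the conformal exponent of the smoothed cone `g_c = e^{2θ(‖x‖²)} δ` on `ℝ⁴` and the radial profile of a
`g_c`-Lipschitz comparison function `Ψ(‖x‖²)`, with

* `θ(s) = log c + ((c−1)/2) log s` for `s ≥ 1` (so `g_c = c² ‖x‖^{2(c−1)} δ`, the exact cone of slope
  `c`, outside the unit ball) and `Ψ(s) = s^{c/2}` for `s ≥ 1` (`Ψ(‖x‖²) = ‖x‖^c`, the cone distance);
* the Lipschitz bound `2 |Ψ'(s)| √s ≤ e^{θ(s)}` (i.e. `|d(Ψ∘‖·‖²)| ≤ e^{θ} ‖·‖`);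
* the two curvature inequalities `θ' + s θ'' ≤ 0` and `12 θ' + 4 s θ'' + 8 s θ'² ≤ 0` (`s ≥ 0`), which
  are the signs of the radial and tangential Ricci eigenvalues of `e^{2θ(‖x‖²)} δ`.

Construction: with the smooth monotone step `m(t) = smoothTransition(2t − 1)` (`0` for `t ≤ 1/2`,
`1` for `t ≥ 1`), `θ(s) = log c + ((c−1)/2) ∫₁ˢ m(t)/t dt` and
`Ψ(s) = 1 + ∫₁ˢ e^{θ(t)} m(t) / (2√t) dt`; then `s θ'(s) = ((c−1)/2) m(s) ∈ [(c−1)/2, 0]` is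
nonincreasing, which gives both curvature signs. Elementary calculus (`Real.smoothTransition`,
FTC `Continuous.integral_hasStrictDerivAt`, `integral_inv`, `integral_rpow`); everything is proved,
no definition, no named fact. [folklore]
-/

noncomputable section

-- the registered namespace `Summit.SmoothPoincare4.SmoothPoincare4.Theorems` repeats a component
set_option linter.dupNamespace false

open scoped ContDiff Topology
open Set Filter MeasureTheory intervalIntegral

namespace Summit.SmoothPoincare4.SmoothPoincare4.Theorems

namespace SmoothedConeModelProfile

/-! ## Generic calculus -/

/-- A primitive of a smooth function is smooth, with the integrand as derivative. [folklore] -/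
theorem contDiff_primitive {φ : ℝ → ℝ} (hφ : ContDiff ℝ ∞ φ) (a : ℝ) :
    ContDiff ℝ ∞ (fun s ↦ ∫ t in a..s, φ t) ∧
      ∀ s, HasDerivAt (fun s ↦ ∫ t in a..s, φ t) (φ s) s := by
  have hd : ∀ s, HasDerivAt (fun s ↦ ∫ t in a..s, φ t) (φ s) s :=
    fun s ↦ (hφ.continuous.integral_hasStrictDerivAt a s).hasDerivAt
  refine ⟨?_, hd⟩
  have hderiv : deriv (fun s ↦ ∫ t in a..s, φ t) = φ := funext fun s ↦ (hd s).deriv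
  exact contDiff_infty_iff_deriv.2 ⟨fun s ↦ (hd s).differentiableAt, by rw [hderiv]; exact hφ⟩

/-- A function that is smooth on `(0, ∞)` and vanishes on `(-∞, 1/2)` is smooth. [folklore] -/
theorem contDiff_of_zero_near_nonpos {φ : ℝ → ℝ} (h0 : ∀ t, t < 1 / 2 → φ t = 0)
    (hpos : ∀ t, 0 < t → ContDiffAt ℝ ∞ φ t) : ContDiff ℝ ∞ φ := by
  refine contDiff_iff_contDiffAt.2 fun t ↦ ?_
  by_cases ht : t < 1 / 2
  · have hev : φ =ᶠ[𝓝 t] fun _ ↦ (0 : ℝ) := by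
      filter_upwards [Iio_mem_nhds ht] with u hu using h0 u hu
    exact (contDiffAt_const (c := (0 : ℝ))).congr_of_eventuallyEq hev
  · exact hpos t (by linarith [not_lt.mp ht])

/-- The derivative of a function vanishing on `(-∞, 1/2)` vanishes there. [folklore] -/
theorem deriv_eq_zero_of_zero_near {φ : ℝ → ℝ} (h0 : ∀ t, t < 1 / 2 → φ t = 0) {t : ℝ}
    (ht : t < 1 / 2) : deriv φ t = 0 := by
  have hev : φ =ᶠ[𝓝 t] fun _ ↦ (0 : ℝ) := by
    filter_upwards [Iio_mem_nhds ht] with u hu using h0 u hu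
  rw [hev.deriv_eq, deriv_const]

/-! ## The step `m(t) = smoothTransition (2t − 1)` -/

section Step

variable {m : ℝ → ℝ} (hm : m = fun t ↦ Real.smoothTransition (2 * t - 1))
include hm

/-- `m` is smooth. [folklore] -/
theorem step_contDiff : ContDiff ℝ ∞ m := by
  rw [hm]
  exact Real.smoothTransition.contDiff.comp ((contDiff_const.mul contDiff_id).sub contDiff_const)

/-- `m = 0` on `(-∞, 1/2]`. [folklore] -/
theorem step_zero {t : ℝ} (ht : t ≤ 1 / 2) : m t = 0 := by
  rw [hm]
  exact Real.smoothTransition.zero_of_nonpos (by linarith)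

/-- `m = 1` on `[1, ∞)`. [folklore] -/
theorem step_one {t : ℝ} (ht : 1 ≤ t) : m t = 1 := by
  rw [hm]
  exact Real.smoothTransition.one_of_one_le (by linarith)

/-- `0 ≤ m`. [folklore] -/
theorem step_nonneg (t : ℝ) : 0 ≤ m t := by
  rw [hm]
  exact Real.smoothTransition.nonneg _

/-- `m ≤ 1`. [folklore] -/
theorem step_le_one (t : ℝ) : m t ≤ 1 := by
  rw [hm]
  exact Real.smoothTransition.le_one _

/-- `m` is monotone, so `m' ≥ 0`. [folklore] -/
theorem step_deriv_nonneg (t : ℝ) : 0 ≤ deriv m t := by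
  have hmono : Monotone m := by
    rw [hm]
    exact Real.smoothTransition.monotone.comp fun a b hab ↦ by linarith
  exact hmono.deriv_nonneg

end Step

/-! ## The integrand `φ(t) = m(t)/t` and the exponent `θ` -/

section Exponent

variable {m φ : ℝ → ℝ} (hm : m = fun t ↦ Real.smoothTransition (2 * t - 1))
  (hφ : φ = fun t ↦ m t * t⁻¹)
include hm hφ

/-- `φ = 0` on `(-∞, 1/2)`. [folklore] -/
theorem phi_zero {t : ℝ} (ht : t < 1 / 2) : φ t = 0 := by
  rw [hφ]
  simp [step_zero hm ht.le]

/-- `φ` is smooth. [folklore] -/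
theorem phi_contDiff : ContDiff ℝ ∞ φ := by
  refine contDiff_of_zero_near_nonpos (fun t ht ↦ phi_zero hm hφ ht) fun t ht ↦ ?_
  rw [hφ]
  exact (step_contDiff hm).contDiffAt.mul (contDiffAt_inv ℝ ht.ne')

/-- `0 ≤ φ`. [folklore] -/
theorem phi_nonneg (t : ℝ) : 0 ≤ φ t := by
  by_cases ht : t < 1 / 2
  · rw [phi_zero hm hφ ht]
  · rw [hφ]
    exact mul_nonneg (step_nonneg hm t) (inv_nonneg.2 (by linarith [not_lt.mp ht]))

/-- `φ(t) = t⁻¹` for `t ≥ 1`. [folklore] -/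
theorem phi_eq_inv {t : ℝ} (ht : 1 ≤ t) : φ t = t⁻¹ := by
  rw [hφ]
  simp [step_one hm ht]

/-- `φ'(t) = m'(t)/t − m(t)/t²` for `t > 0`. [folklore] -/
theorem phi_hasDerivAt {t : ℝ} (ht : 0 < t) :
    HasDerivAt φ (deriv m t * t⁻¹ + m t * (-(t ^ 2)⁻¹)) t := by
  rw [hφ]
  have h1 : HasDerivAt m (deriv m t) t :=
    ((step_contDiff hm).differentiable (by simp)).differentiableAt.hasDerivAt
  exact h1.mul (hasDerivAt_inv ht.ne')

/-- The key identity `φ(s) + s φ'(s) = m'(s)` (`(s θ')' ∝ m'`), all `s`. [folklore] -/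
theorem phi_add_deriv_mul (s : ℝ) : φ s + deriv φ s * s = deriv m s := by
  by_cases hs : s < 1 / 2
  · rw [phi_zero hm hφ hs, deriv_eq_zero_of_zero_near (fun t ht ↦ phi_zero hm hφ ht) hs,
      deriv_eq_zero_of_zero_near (fun t ht ↦ step_zero hm ht.le) hs]
    ring
  · have hs0 : 0 < s := by linarith [not_lt.mp hs]
    rw [(phi_hasDerivAt hm hφ hs0).deriv, hφ]
    field_simp
    ring

/-- `s φ(s) = m(s)` for all `s`. [folklore] -/
theorem phi_mul_self (s : ℝ) : φ s * s = m s := by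
  by_cases hs : s < 1 / 2
  · rw [phi_zero hm hφ hs, step_zero hm hs.le, zero_mul]
  · have hs0 : 0 < s := by linarith [not_lt.mp hs]
    rw [hφ]
    field_simp

variable {c : ℝ} {θ : ℝ → ℝ} (hθ : θ = fun s ↦ Real.log c + (c - 1) / 2 * ∫ t in (1 : ℝ)..s, φ t)
include hθ

/-- `θ` is smooth. [folklore] -/
theorem theta_contDiff : ContDiff ℝ ∞ θ := by
  rw [hθ]
  exact contDiff_const.add (contDiff_const.mul (contDiff_primitive (phi_contDiff hm hφ) 1).1)

/-- `θ'(s) = ((c−1)/2) φ(s)`. [folklore] -/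
theorem theta_hasDerivAt (s : ℝ) : HasDerivAt θ ((c - 1) / 2 * φ s) s := by
  rw [hθ]
  exact (((contDiff_primitive (phi_contDiff hm hφ) 1).2 s).const_mul _).const_add _

/-- `θ' = ((c−1)/2) φ` as functions. [folklore] -/
theorem theta_deriv_eq : deriv θ = fun s ↦ (c - 1) / 2 * φ s :=
  funext fun s ↦ (theta_hasDerivAt hm hφ hθ s).deriv

/-- `θ''(s) = ((c−1)/2) φ'(s)`. [folklore] -/
theorem theta_deriv_deriv (s : ℝ) : deriv (deriv θ) s = (c - 1) / 2 * deriv φ s := by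
  rw [theta_deriv_eq hm hφ hθ]
  exact deriv_const_mul _ ((phi_contDiff hm hφ).differentiable (by simp)).differentiableAt

/-- **The cone outside the unit ball**: `θ(s) = log c + ((c−1)/2) log s` for `s ≥ 1`
(`∫₁ˢ dt/t = log s`). [folklore] -/
theorem theta_eq_of_one_le {s : ℝ} (hs : 1 ≤ s) : θ s = Real.log c + (c - 1) / 2 * Real.log s := by
  rw [hθ]
  dsimp only
  congr 2
  have h1 : ∫ t in (1 : ℝ)..s, φ t = ∫ t in (1 : ℝ)..s, t⁻¹ := by
    refine integral_congr fun t ht ↦ ?_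
    rw [uIcc_of_le hs] at ht
    exact phi_eq_inv hm hφ ht.1
  rw [h1, integral_inv (by rw [uIcc_of_le hs]; exact fun h ↦ by linarith [h.1]), div_one]

/-- **Radial curvature sign**: `θ'(s) + s θ''(s) = ((c−1)/2) m'(s) ≤ 0` for `c ≤ 1`. [folklore] -/
theorem theta_radial (hc1 : c ≤ 1) (s : ℝ) : deriv θ s + deriv (deriv θ) s * s ≤ 0 := by
  rw [theta_deriv_deriv hm hφ hθ, theta_deriv_eq hm hφ hθ]
  have h := phi_add_deriv_mul hm hφ s
  have hk : (c - 1) / 2 ≤ 0 := by linarith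
  have hm' := step_deriv_nonneg hm s
  nlinarith

/-- **Tangential curvature sign**: `12θ' + 4sθ'' + 8sθ'² = 4k m' + 8kφ(1 + k m) ≤ 0` with
`k = (c−1)/2 ∈ (−1/2, 0]`, for `0 < c ≤ 1`. [folklore] -/
theorem theta_tangential (hc : 0 < c) (hc1 : c ≤ 1) (s : ℝ) :
    12 * deriv θ s + 4 * deriv (deriv θ) s * s + 8 * deriv θ s ^ 2 * s ≤ 0 := by
  rw [theta_deriv_deriv hm hφ hθ, theta_deriv_eq hm hφ hθ]
  have h := phi_add_deriv_mul hm hφ s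
  have h2 := phi_mul_self hm hφ s
  have hk : (c - 1) / 2 ≤ 0 := by linarith
  have hk' : -1 / 2 < (c - 1) / 2 := by linarith
  have hm' := step_deriv_nonneg hm s
  have hm0 := step_nonneg hm s
  have hm1 := step_le_one hm s
  have hφ0 := phi_nonneg hm hφ s
  -- `12kφ + 4kφ's + 8k²φ²s = 4k(φ + φ's) + 8kφ(1 + k φ s) = 4k m' + 8 k φ (1 + k m)`
  have key : 12 * ((c - 1) / 2 * φ s) + 4 * ((c - 1) / 2 * deriv φ s) * s +
      8 * ((c - 1) / 2 * φ s) ^ 2 * s =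
      4 * ((c - 1) / 2) * deriv m s + 8 * ((c - 1) / 2 * φ s) * (1 + (c - 1) / 2 * m s) := by
    rw [← h, ← h2]; ring
  rw [key]
  have t1 : 4 * ((c - 1) / 2) * deriv m s ≤ 0 := by nlinarith
  have t2 : (c - 1) / 2 * φ s ≤ 0 := by nlinarith
  have t3 : 0 ≤ 1 + (c - 1) / 2 * m s := by nlinarith
  nlinarith [mul_nonneg (neg_nonneg.2 t2) t3]

/-! ## The comparison profile `Ψ` -/

omit hφ hθ in
/-- The factor `m(t)/√t` is smooth (it vanishes near `t ≤ 0`). [folklore] -/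
theorem sqrtFactor_contDiff : ContDiff ℝ ∞ fun t ↦ m t * (Real.sqrt t)⁻¹ := by
  refine contDiff_of_zero_near_nonpos (fun t ht ↦ by simp [step_zero hm ht.le]) fun t ht ↦ ?_
  exact (step_contDiff hm).contDiffAt.mul
    ((Real.contDiffAt_sqrt ht.ne').inv ((Real.sqrt_pos.2 ht).ne'))

/-- The integrand of `Ψ` is smooth. [folklore] -/
theorem psiIntegrand_contDiff :
    ContDiff ℝ ∞ fun t ↦ Real.exp (θ t) * (m t * (Real.sqrt t)⁻¹) / 2 :=
  ((Real.contDiff_exp.comp (theta_contDiff hm hφ hθ)).mul (sqrtFactor_contDiff hm)).div_const 2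

variable {Ψ : ℝ → ℝ}

/-- `Ψ` is smooth. [folklore] -/
theorem psi_contDiff
    (hΨ : Ψ = fun s ↦ 1 + ∫ t in (1 : ℝ)..s, Real.exp (θ t) * (m t * (Real.sqrt t)⁻¹) / 2) :
    ContDiff ℝ ∞ Ψ := by
  rw [hΨ]
  exact contDiff_const.add (contDiff_primitive (psiIntegrand_contDiff hm hφ hθ) 1).1

/-- `Ψ'(s) = e^{θ(s)} m(s) / (2√s)`. [folklore] -/
theorem psi_hasDerivAt
    (hΨ : Ψ = fun s ↦ 1 + ∫ t in (1 : ℝ)..s, Real.exp (θ t) * (m t * (Real.sqrt t)⁻¹) / 2) (s : ℝ) :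
    HasDerivAt Ψ (Real.exp (θ s) * (m s * (Real.sqrt s)⁻¹) / 2) s := by
  rw [hΨ]
  exact ((contDiff_primitive (psiIntegrand_contDiff hm hφ hθ) 1).2 s).const_add _

/-- **The Lipschitz bound** `2 |Ψ'(s)| √s ≤ e^{θ(s)}` (`= e^{θ} m ≤ e^{θ}` for `s > 0`). [folklore] -/
theorem psi_lipschitz
    (hΨ : Ψ = fun s ↦ 1 + ∫ t in (1 : ℝ)..s, Real.exp (θ t) * (m t * (Real.sqrt t)⁻¹) / 2) (s : ℝ) :
    2 * |deriv Ψ s| * Real.sqrt s ≤ Real.exp (θ s) := by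
  rw [(psi_hasDerivAt hm hφ hθ hΨ s).deriv]
  have hm0 := step_nonneg hm s
  have hm1 := step_le_one hm s
  have he := Real.exp_pos (θ s)
  rcases le_or_gt s 0 with hs | hs
  · rw [Real.sqrt_eq_zero'.2 hs, mul_zero]
    exact he.le
  · have hsq : 0 < Real.sqrt s := Real.sqrt_pos.2 hs
    rw [abs_of_nonneg (by positivity)]
    have : 2 * (Real.exp (θ s) * (m s * (Real.sqrt s)⁻¹) / 2) * Real.sqrt s =
        Real.exp (θ s) * m s := by
      field_simp
    rw [this]
    nlinarith

/-- **The cone distance outside the unit ball**: `Ψ(s) = s^{c/2}` for `s ≥ 1` (there the integrand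
is `(c/2) t^{c/2−1}`). [folklore] -/
theorem psi_eq_of_one_le
    (hΨ : Ψ = fun s ↦ 1 + ∫ t in (1 : ℝ)..s, Real.exp (θ t) * (m t * (Real.sqrt t)⁻¹) / 2)
    (hc : 0 < c) {s : ℝ} (hs : 1 ≤ s) : Ψ s = s ^ (c / 2) := by
  rw [hΨ]
  dsimp only
  have h1 : ∫ t in (1 : ℝ)..s, Real.exp (θ t) * (m t * (Real.sqrt t)⁻¹) / 2 =
      ∫ t in (1 : ℝ)..s, c / 2 * t ^ (c / 2 - 1) := by
    refine integral_congr fun t ht ↦ ?_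
    rw [uIcc_of_le hs] at ht
    have ht0 : 0 < t := by linarith [ht.1]
    rw [theta_eq_of_one_le hm hφ hθ ht.1, step_one hm ht.1, one_mul, Real.exp_add, Real.exp_log hc,
      Real.sqrt_eq_rpow, ← Real.rpow_neg ht0.le, show (c - 1) / 2 * Real.log t = Real.log t * ((c - 1) / 2) by ring,
      ← Real.rpow_def_of_pos ht0]
    rw [show c / 2 - 1 = (c - 1) / 2 + -(1 / 2 : ℝ) by ring, Real.rpow_add ht0]
    ring
  rw [h1, intervalIntegral.integral_const_mul, integral_rpow (Or.inl (by linarith)),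
    show c / 2 - 1 + 1 = c / 2 by ring, Real.one_rpow]
  have hc2 : c / 2 ≠ 0 := by positivity
  field_simp
  ring

end Exponent

end SmoothedConeModelProfile

open SmoothedConeModelProfile in
/-- **Aux 2 of stub `helper_smoothedConeModel`: the radial profile of the smoothed cone.** For
`0 < c ≤ 1` there are smooth `θ, Ψ : ℝ → ℝ` with `θ(s) = log c + ((c−1)/2) log s` and
`Ψ(s) = s^{c/2}` for `s ≥ 1`, the Lipschitz bound `2|Ψ'(s)|√s ≤ e^{θ(s)}`, and the curvature signs
`θ' + sθ'' ≤ 0`, `12θ' + 4sθ'' + 8sθ'² ≤ 0` for `s ≥ 0` (so that `e^{2θ(‖x‖²)} δ` is a complete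
`Ric ≥ 0` smoothing of the cone `c²‖x‖^{2c−2} δ` on `ℝ⁴`, see the companion files). [folklore] -/
theorem helper_smoothedConeModel_profile :
    ∀ c : ℝ, 0 < c → c ≤ 1 →
      ∃ θ Ψ : ℝ → ℝ, ContDiff ℝ ∞ θ ∧ ContDiff ℝ ∞ Ψ ∧
        (∀ s : ℝ, 1 ≤ s → θ s = Real.log c + (c - 1) / 2 * Real.log s) ∧
        (∀ s : ℝ, 1 ≤ s → Ψ s = s ^ (c / 2)) ∧
        (∀ s : ℝ, 2 * |deriv Ψ s| * Real.sqrt s ≤ Real.exp (θ s)) ∧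
        (∀ s : ℝ, 0 ≤ s → deriv θ s + deriv (deriv θ) s * s ≤ 0) ∧
        (∀ s : ℝ, 0 ≤ s → 12 * deriv θ s + 4 * deriv (deriv θ) s * s + 8 * deriv θ s ^ 2 * s ≤ 0) := by
  intro c hc hc1
  set m : ℝ → ℝ := fun t ↦ Real.smoothTransition (2 * t - 1) with hm
  set φ : ℝ → ℝ := fun t ↦ m t * t⁻¹ with hφ
  set θ : ℝ → ℝ := fun s ↦ Real.log c + (c - 1) / 2 * ∫ t in (1 : ℝ)..s, φ t with hθ
  set Ψ : ℝ → ℝ := fun s ↦ 1 + ∫ t in (1 : ℝ)..s, Real.exp (θ t) * (m t * (Real.sqrt t)⁻¹) / 2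
    with hΨ
  exact ⟨θ, Ψ, theta_contDiff hm hφ hθ, psi_contDiff hm hφ hθ hΨ,
    fun s hs ↦ theta_eq_of_one_le hm hφ hθ hs, fun s hs ↦ psi_eq_of_one_le hm hφ hθ hΨ hc hs,
    fun s ↦ psi_lipschitz hm hφ hθ hΨ s, fun s _ ↦ theta_radial hm hφ hθ hc1 s,
    fun s _ ↦ theta_tangential hm hφ hθ hc hc1 s⟩

end Summit.SmoothPoincare4.SmoothPoincare4.Theorems
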